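import Summits.NavierStokesRegularity.NavierStokesRegularity.Theorems.ScenarioCensusRowF1SnapshotTopZoom
import HarnessLib

/-!
# LINE «snapshot-top» port, part 3/4: §5 the snapshot row proved (`rowF1cs_holds`), the definite threshold `calmLevel`, the EVERY-TIME floor `SnapshotFloor`, residual
# `SnapshotCollapse` ≡ `Row_F1`, order vs this seat's porous-top row `Row_F1po` (restated; `rowF1po_of_rowF1cs`)

Re-homed for the scenario census (typer seat ns-census-typer-1 g9; the cells F1cs / F1ce / F1rs and the floors are members of row F1 «DECIDED IN KERNEL IN FILES» (item 75; ref
ns-census-ref g13 PRE-CHECK ✓ §18.16; critic PASS; lead label); this port makes them TREE-decided): VERBATIM PORT of ns-idea-3 LINE «snapshot-top»,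
`pub/ideators/ns-idea-3/lines/snapshot-top/line-snapshot-top.lean` sha16 5c984c2d30725568 (996 l., lean check rc 0, 0 sorry), split for the 400-line rule into
`ScenarioCensusRowF1SnapshotTop` (§1–§2) → `…SnapshotTopZoom` (§3–§4) → `…SnapshotTopRows` (§5) → `…SnapshotTopRigid` (§6–§7 + census KEYS).  Lean text VERBATIM in namespace
`…Theorems.ScenarioCensus.SnapshotTop` (the line's `…Cruxes.ScenarioCensusRowF1.SnapshotTopLine` re-homed); port edits: LINE 34's `topSet` (+ lemmas) and LINE 35's
`HasTypeIConstant` (+ lemmas), restated VERBATIM by the line, are taken BY NAME from the landed two-time-top / one-level-top ports; the second proof term `rowF1po_holds` is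
not re-declared; `@[conjecture]` on the residual `SnapshotCollapse` (≡ `ScenarioCensus.Row_F1`, OPEN); ten one-line docstrings added (gate lint).  Statements untouched.

No census VALUE is moved here (row F1 stays OPEN-WITH-LINE; the members become TREE-decided by name); NS regularity is NOT proved; `Row_F1` is untouched (zero
movement, `snapshotCollapse_iff_rowF1`); no summit statement is proved by this file.
-/

-- the summit and its single problem share the name `NavierStokesRegularity` (D-0017 nested layout)
set_option linter.dupNamespace false

noncomputable section

open MeasureTheory Set Function Filter TopologicalSpace Metric
open scoped Topology NNReal ENNReal

namespace Summit.NavierStokesRegularity.NavierStokesRegularity.Theorems.ScenarioCensus.SnapshotTop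

open Literature.Analysis Literature.Analysis.FluidPDE
open Summit.NavierStokesRegularity.NavierStokesRegularity.Theorems
open Summit.NavierStokesRegularity.NavierStokesRegularity.Theses

/-! ## §5 The SNAPSHOT ROW, proved; the definite threshold `calmLevel M A a`; the EVERY-TIME floor; residual ≡ row F1; order -/

/-- **ROW F1cs holds** (snapshot package of §3 + calm-pocket level of §4). -/
theorem rowF1cs_holds : Row_F1cs := by
  intro M A a ha
  obtain ⟨Λ₁, hΛ₁, hlev⟩ := exists_calmLevel M A a ha snapLevel_pos
  refine ⟨Λ₁, hΛ₁, ?_⟩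
  intro ν T hν hT u p hsol hLH hdec hM hfreq
  by_contra hmax
  obtain ⟨c, x, W, hcpos, -, hW, hQ, hxfast, hconv, -, hnorm⟩ :=
    exists_snapshotZoom_package hν hT hsol hLH hdec hM hmax hfreq
  apply hlev W hW hnorm
  -- the snapshot hypothesis at the centre times, read in the zoom: calm pockets of radius `a` about `ζ_j ∈ closedBall 0 A`
  have hunit : ∀ j, Real.sqrt (ν * (T - (T + c j ^ 2 * ν * (-1)))) = c j * ν := by
    intro j
    rw [show T - (T + c j ^ 2 * ν * (-1)) = c j ^ 2 * ν by ring]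
    exact sqrt_mul_sq_mul hν (hcpos j)
  have hsq : ∀ j, Real.sqrt (T - (T + c j ^ 2 * ν * (-1))) = c j * Real.sqrt ν := by
    intro j
    rw [show T - (T + c j ^ 2 * ν * (-1)) = c j ^ 2 * ν by ring, Real.sqrt_mul (sq_nonneg _),
      Real.sqrt_sq (hcpos j).le]
  have hpk : ∀ j, ∃ ζ : E3, ζ ∈ closedBall (0 : E3) A ∧ ∀ y ∈ closedBall ζ a,
      ‖(c j * 1) • u (T + c j ^ 2 * ν * (-1)) (x j + (c j * ν) • y)‖ ≤ Λ₁ := by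
    intro j
    obtain ⟨z, hzx, hcalm⟩ := hQ j (x j) (hxfast j)
    have hcν : 0 < c j * ν := mul_pos (hcpos j) hν
    refine ⟨(c j * ν)⁻¹ • (z - x j), ?_, fun y hy => ?_⟩
    · rw [mem_closedBall, dist_zero_right, norm_smul, norm_inv, Real.norm_eq_abs, abs_of_pos hcν,
        inv_mul_le_iff₀ hcν]
      rw [hunit j] at hzx
      linarith
    · have hx' : ‖x j + (c j * ν) • y - z‖ ≤ a * Real.sqrt (ν * (T - (T + c j ^ 2 * ν * (-1)))) := by
        rw [hunit j]
        have e : x j + (c j * ν) • y - z = (c j * ν) • (y - (c j * ν)⁻¹ • (z - x j)) := by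
          rw [smul_sub, smul_smul, mul_inv_cancel₀ hcν.ne', one_smul]
          abel
        rw [e, norm_smul, Real.norm_eq_abs, abs_of_pos hcν]
        rw [mem_closedBall, dist_eq_norm] at hy
        nlinarith
      have h1 := hcalm _ hx'
      rw [hsq j] at h1
      rw [norm_smul, Real.norm_eq_abs, abs_of_pos (mul_pos (hcpos j) one_pos), mul_one]
      have h2 : c j * ‖u (T + c j ^ 2 * ν * (-1)) (x j + (c j * ν) • y)‖ * Real.sqrt ν ≤ Λ₁ * Real.sqrt ν := by
        linarith [h1, mul_comm (Real.sqrt ν) ‖u (T + c j ^ 2 * ν * (-1)) (x j + (c j * ν) • y)‖,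
          mul_assoc (c j) (Real.sqrt ν) ‖u (T + c j ^ 2 * ν * (-1)) (x j + (c j * ν) • y)‖]
      exact le_of_mul_le_mul_right h2 (Real.sqrt_pos.2 hν)
  choose ζ hζ hcalmζ using hpk
  obtain ⟨ζ₀, hζ₀, hlim⟩ := pocket_limit ha hζ (tendsto_const_nhds (x := Λ₁))
    (fun y => hconv (-1) (by norm_num) y) hcalmζ
  exact ⟨ζ₀, hζ₀, hlim⟩

/-- **Row F1ce holds.** -/
theorem rowF1ce_holds : Row_F1ce := rowF1ce_of_rowF1cs rowF1cs_holds

/-- **The definite calm threshold `ε(M, A, a)`** of the snapshot row (a choice; `1` for `a ≤ 0`, where nothing is claimed).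
Ineffective (compactness). -/
def calmLevel (M A a : ℝ) : ℝ := if ha : 0 < a then Classical.choose (rowF1cs_holds M A a ha) else 1

/-- The definite calm threshold is positive. -/
theorem calmLevel_pos (M A a : ℝ) : 0 < calmLevel M A a := by
  unfold calmLevel
  split_ifs with ha
  · exact (Classical.choose_spec (rowF1cs_holds M A a ha)).1
  · exact one_pos

/-- **Row F1cs at the named threshold.** -/
theorem calmLevel_spec {a : ℝ} (M A : ℝ) (ha : 0 < a) :
    ∀ (ν T : ℝ), 0 < ν → 0 < T → ∀ (u : ℝ → E3 → E3) (p : ℝ → E3 → ℝ),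
    IsClassicalNSSolutionOn (Ico 0 T) ν 0 u p → IsLerayHopfOn T ν 0 (u 0) u →
    HasRapidSpatialDecay (u 0) → OneLevelTop.HasTypeIConstant ν T M u →
    (∃ᶠ t in 𝓝[<] T, CalmPocketsAt ν T u snapLevel A a (calmLevel M A a) t) →
    HasSmoothExtensionPast ν 0 u T := by
  have e : calmLevel M A a = Classical.choose (rowF1cs_holds M A a ha) := by
    unfold calmLevel; rw [dif_pos ha]
  rw [e]
  exact (Classical.choose_spec (rowF1cs_holds M A a ha)).2

/-- Reading of the negated snapshot condition: some `Λ`-fast point such that EVERY closed ball of radius `a√(ν(T−t))` centred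
within `A√(ν(T−t))` of it contains a point of dimensionless speed `> ε`. -/
theorem not_calmPocketsAt_iff {ν T : ℝ} {u : ℝ → E3 → E3} {Λ A a ε t : ℝ} :
    ¬ CalmPocketsAt ν T u Λ A a ε t ↔ ∃ x ∈ TwoTimeTop.topSet ν T u Λ t, ∀ z : E3, ‖z - x‖ ≤ A * Real.sqrt (ν * (T - t)) →
      ∃ x' : E3, ‖x' - z‖ ≤ a * Real.sqrt (ν * (T - t)) ∧ ε * Real.sqrt ν < Real.sqrt (T - t) * ‖u t x'‖ := by
  unfold CalmPocketsAt
  push Not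
  rfl

/-- **THE EVERY-TIME FLOOR «NO CALM POCKETS, AT ANY LATE INSTANT»** (structural, maximal frame): at a maximal Type-I Clay blow-up
with dimensionless constant `M`, for every reach `A` and radius `a > 0`, at EVERY instant `t` close enough to `T` some `c_S`-fast
point has NO `ε(M, A, a)`-calm pocket of radius `a√(ν(T−t))` within `A√(ν(T−t))` — every such ball carries fluid of dimensionless
speed `> ε(M, A, a)`.  The first floor of this seat holding at ALL late times (earlier floors: «recurrently», `∃ᶠ`).  PROVED. -/
def SnapshotFloor : Prop :=
  ∀ (ν T : ℝ), 0 < ν → 0 < T → ∀ (u : ℝ → E3 → E3) (p : ℝ → E3 → ℝ),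
    IsMaximalSmoothSolution ν 0 u p T → IsLerayHopfOn T ν 0 (u 0) u → HasRapidSpatialDecay (u 0) →
    ∀ M A a : ℝ, OneLevelTop.HasTypeIConstant ν T M u → 0 < a →
      ∀ᶠ t in 𝓝[<] T, ¬ CalmPocketsAt ν T u snapLevel A a (calmLevel M A a) t

/-- **The EVERY-TIME (snapshot) floor holds.** -/
theorem snapshotFloor_holds : SnapshotFloor := by
  intro ν T hν hT u p hmax hLH hdec M A a hM ha
  by_contra hno
  rw [Filter.not_eventually] at hno
  apply hmax.2 (calmLevel_spec M A ha ν T hν hT u p hmax.1 hLH hdec hM ?_)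
  exact hno.mono fun t ht => not_not.1 ht

/-- The floor read pointwise: eventually in `t`, a `c_S`-fast point near which every pocket carries an `ε(M,A,a)`-fast point. -/
theorem snapshotFloor_read {ν T : ℝ} (hν : 0 < ν) (hT : 0 < T) {u : ℝ → E3 → E3} {p : ℝ → E3 → ℝ}
    (hmax : IsMaximalSmoothSolution ν 0 u p T) (hLH : IsLerayHopfOn T ν 0 (u 0) u) (hdec : HasRapidSpatialDecay (u 0))
    {M A a : ℝ} (hM : OneLevelTop.HasTypeIConstant ν T M u) (ha : 0 < a) :
    ∀ᶠ t in 𝓝[<] T, ∃ x ∈ TwoTimeTop.topSet ν T u snapLevel t, ∀ z : E3, ‖z - x‖ ≤ A * Real.sqrt (ν * (T - t)) →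
      ∃ x' : E3, ‖x' - z‖ ≤ a * Real.sqrt (ν * (T - t)) ∧
        calmLevel M A a * Real.sqrt ν < Real.sqrt (T - t) * ‖u t x'‖ :=
  (snapshotFloor_holds ν T hν hT u p hmax hLH hdec M A a hM ha).mono fun _ ht => not_calmPocketsAt_iff.1 ht

/-- **Residual «SNAPSHOT COLLAPSE»** (maximal frame): every maximal Type-I Clay blow-up with constant `M` admits, for some reach
`A` and radius `a > 0`, calm-pocket snapshots at the threshold `ε(M, A, a)` along some sequence of instants `t_k ↑ T`.  DECLARED
≡ row F1 (`snapshotCollapse_iff_rowF1`); no movement on `Row_F1` is claimed. -/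
@[conjecture] def SnapshotCollapse : Prop :=
  ∀ (ν T : ℝ), 0 < ν → 0 < T → ∀ (u : ℝ → E3 → E3) (p : ℝ → E3 → ℝ),
    IsMaximalSmoothSolution ν 0 u p T → IsLerayHopfOn T ν 0 (u 0) u → HasRapidSpatialDecay (u 0) →
    ∀ M : ℝ, OneLevelTop.HasTypeIConstant ν T M u →
      ∃ A a : ℝ, 0 < a ∧ ∃ᶠ t in 𝓝[<] T, CalmPocketsAt ν T u snapLevel A a (calmLevel M A a) t

/-- **The split**: snapshot row (proved) + residual ⇒ row F1 (target BY NAME). -/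
theorem rowF1_of_snapshotCollapse (hR : SnapshotCollapse) : ScenarioCensus.Row_F1 := by
  unfold ScenarioCensus.Row_F1
  intro ν T hν hT u p hsol hLH hdec hTI
  by_contra hext
  obtain ⟨M, hM⟩ := OneLevelTop.exists_hasTypeIConstant hν hTI
  obtain ⟨A, a, ha, hfreq⟩ := hR ν T hν hT u p ⟨hsol, hext⟩ hLH hdec M hM
  exact hext (calmLevel_spec M A ha ν T hν hT u p hsol hLH hdec hM hfreq)

/-- The residual is a consequence of row F1 (vacuously). -/
theorem snapshotCollapse_of_rowF1 (h : ScenarioCensus.Row_F1) : SnapshotCollapse :=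
  fun ν T hν hT u p hmax hLH hdec _ hM =>
    (hmax.2 (h ν T hν hT u p hmax.1 hLH hdec hM.isTypeIBlowup)).elim

/-- The residual `SnapshotCollapse` is EXACTLY `Row_F1`. -/
theorem snapshotCollapse_iff_rowF1 : SnapshotCollapse ↔ ScenarioCensus.Row_F1 :=
  ⟨rowF1_of_snapshotCollapse, snapshotCollapse_of_rowF1⟩

/-! ### Order: the snapshot row contains this seat's earlier POROUS-TOP row (LINE «caged-top», `Row_F1po`), strictly on two axes

`Row_F1po` (copied VERBATIM below with its objects) asked for SUBCRITICAL pores (`|u| ≤ Λ(t)`, `Λ(t)√(T−t) → 0`) near every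
`Λ(t)`-fast point at ALL late times; `Row_F1cs` accepts CRITICAL pockets (dimensionless speed `≤ ε(M, A, a)`) at a mere SEQUENCE of
instants.  `rowF1po_of_rowF1cs` records the containment in kernel. -/

/-- (LINE «caged-top», verbatim) **Porous top at the (moving) level `Λ` with constants `A`, `a`**. -/
def HasPorousTopAt (ν T : ℝ) (Λ : ℝ → ℝ) (A a : ℝ) (u : ℝ → E3 → E3) : Prop :=
  ∀ᶠ t in 𝓝[<] T, ∀ x : E3, Λ t < ‖u t x‖ → ∃ z : E3, ‖z - x‖ ≤ A * Real.sqrt (ν * (T - t)) ∧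
    ∀ x' : E3, ‖x' - z‖ < a * Real.sqrt (ν * (T - t)) → ‖u t x'‖ ≤ Λ t

/-- (LINE «caged-top», verbatim) **Subcritical level**: `Λ(t) √(T − t) → 0` as `t ↑ T`. -/
def IsSubcriticalLevel (T : ℝ) (Λ : ℝ → ℝ) : Prop :=
  Tendsto (fun t => Λ t * Real.sqrt (T - t)) (𝓝[<] T) (𝓝 0)

/-- (LINE «caged-top», verbatim) **Porous top**: some subcritical moving level `Λ(t)` and some `A`, `a > 0` make the top porous. -/
def HasPorousTop (ν T : ℝ) (u : ℝ → E3 → E3) : Prop :=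
  ∃ (Λ : ℝ → ℝ) (A a : ℝ), IsSubcriticalLevel T Λ ∧ 0 < a ∧ HasPorousTopAt ν T Λ A a u

/-- (LINE «caged-top», verbatim) **Criterion row F1po** (POROUS top, subcritical moving level). -/
def Row_F1po : Prop :=
  ∀ (ν T : ℝ), 0 < ν → 0 < T →
    ∀ (u : ℝ → E3 → E3) (p : ℝ → E3 → ℝ),
    IsClassicalNSSolutionOn (Ico 0 T) ν 0 u p → IsLerayHopfOn T ν 0 (u 0) u →
    HasRapidSpatialDecay (u 0) → IsTypeIBlowup u T → HasPorousTop ν T u →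
    HasSmoothExtensionPast ν 0 u T

/-- **A porous top yields calm-pocket snapshots at EVERY positive threshold** (subcritical pores are eventually `ε`-calm at the
critical scale, and eventually every `c_S`-fast point is `Λ(t)`-fast). -/
theorem eventually_calmPocketsAt_of_porous {ν T : ℝ} (hν : 0 < ν) {u : ℝ → E3 → E3} {Λ : ℝ → ℝ} {A a ε : ℝ}
    (hsub : IsSubcriticalLevel T Λ) (ha : 0 < a) (hpor : HasPorousTopAt ν T Λ A a u) (hε : 0 < ε) :
    ∀ᶠ t in 𝓝[<] T, CalmPocketsAt ν T u snapLevel A (a / 2) ε t := by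
  have hb : 0 < min snapLevel ε * Real.sqrt ν := mul_pos (lt_min snapLevel_pos hε) (Real.sqrt_pos.2 hν)
  have hsmall : ∀ᶠ t in 𝓝[<] T, Λ t * Real.sqrt (T - t) < min snapLevel ε * Real.sqrt ν :=
    hsub.eventually (eventually_lt_nhds hb)
  have hlt : ∀ᶠ t in 𝓝[<] T, t < T := eventually_nhdsWithin_of_forall fun t ht => ht
  filter_upwards [hsmall, hpor, hlt] with t hsm hpo htT x hx
  have hTt : 0 < T - t := sub_pos.2 htT
  have hst : 0 < Real.sqrt (T - t) := Real.sqrt_pos.2 hTt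
  have hunit : 0 < Real.sqrt (ν * (T - t)) := Real.sqrt_pos.2 (mul_pos hν hTt)
  have hmin1 : min snapLevel ε * Real.sqrt ν ≤ snapLevel * Real.sqrt ν :=
    mul_le_mul_of_nonneg_right (min_le_left _ _) (Real.sqrt_nonneg ν)
  have hmin2 : min snapLevel ε * Real.sqrt ν ≤ ε * Real.sqrt ν :=
    mul_le_mul_of_nonneg_right (min_le_right _ _) (Real.sqrt_nonneg ν)
  -- `x` is `Λ(t)`-fast
  have hxfast : Λ t < ‖u t x‖ := by
    rw [TwoTimeTop.mem_topSet] at hx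
    have h1 : Λ t * Real.sqrt (T - t) < ‖u t x‖ * Real.sqrt (T - t) := by
      linarith [mul_comm (Real.sqrt (T - t)) ‖u t x‖]
    exact lt_of_mul_lt_mul_right h1 hst.le
  obtain ⟨z, hzx, hpore⟩ := hpo x hxfast
  refine ⟨z, hzx, fun x' hx' => ?_⟩
  have hx'lt : ‖x' - z‖ < a * Real.sqrt (ν * (T - t)) := by
    have h : a / 2 * Real.sqrt (ν * (T - t)) < a * Real.sqrt (ν * (T - t)) := by nlinarith
    exact lt_of_le_of_lt hx' h
  have hux' : ‖u t x'‖ ≤ Λ t := hpore x' hx'lt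
  calc Real.sqrt (T - t) * ‖u t x'‖ ≤ Real.sqrt (T - t) * Λ t := mul_le_mul_of_nonneg_left hux' hst.le
    _ = Λ t * Real.sqrt (T - t) := mul_comm _ _
    _ ≤ ε * Real.sqrt ν := (le_of_lt hsm).trans hmin2

/-- **ORDER: `Row_F1cs ⟹ Row_F1po`** (kernel): the snapshot row contains the porous-top row. -/
theorem rowF1po_of_rowF1cs (h : Row_F1cs) : Row_F1po := by
  intro ν T hν hT u p hsol hLH hdec hTI hpt
  obtain ⟨Λ, A, a, hsub, ha, hpor⟩ := hpt
  obtain ⟨M, hM⟩ := OneLevelTop.exists_hasTypeIConstant hν hTI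
  obtain ⟨ε, hε, hrow⟩ := h M A (a / 2) (by positivity)
  exact hrow ν T hν hT u p hsol hLH hdec hM (eventually_calmPocketsAt_of_porous hν hsub ha hpor hε).frequently

-- `rowF1po_holds`: a second proof term for this seat's row F1po (statement identical to the landed `CagedTop.rowF1po_holds`); not re-declared — the order route is `rowF1po_of_rowF1cs rowF1cs_holds`.

end Summit.NavierStokesRegularity.NavierStokesRegularity.Theorems.ScenarioCensus.SnapshotTop

end
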